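import Summits.AnomalousDissipation.AnomalousDissipation.Theorems.SolenoidalFractalHomogenisationLagrangianStepLedgerModes
import Summits.AnomalousDissipation.AnomalousDissipation.Theorems.SolenoidalFractalHomogenisationLagrangianStepLedgerReal
import HarnessLib

/-!
# K1L_D (stmt-AnomalousDissipation-27980), stub S23″: the DISSIPATION FLOOR from modal tracking (S3′ brick D4)
# (helper; `--supports … --as helper`)

The window ledger's (DD) hypothesis is checked with `dd_assembly(_weighted)` (`…LedgerDD`), which needs the floors
`𝔇 ≥ c·(Σ_ℓ d_ℓ X_ℓ² + …)`, `d_ℓ = min(1, r_ℓ τ)`.  This file turns MODAL TRACKING of the level-`m` window map (the effective frame flow tracks the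
explicit flat modal decay `e^{−r_ℓ τ}` up to `ε·d_ℓ` — companion (E_G′)) plus an upper bound on the evolved energy by the tracked modal amplitudes
(Parseval + whatever is not tracked) into that floor: `Σ X² − E′ ≥ ((1 − e^{−2}) − 3ε)·Σ d_ℓ X_ℓ²` — `dissip_lower_of_tracking` (p646016) composed with
`one_sub_exp_ge_min` (p652956).  Pure real algebra.  Infrastructure for rung F-D1.A0; NOT a proof of the crux or of anomalous dissipation.
-/

set_option linter.dupNamespace false

namespace Summit.AnomalousDissipation.AnomalousDissipation.Theorems.SolenoidalFractalHomogenisation.LagrangianStep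

open Finset

/-- **Dissipation floor from modal tracking.**  Modes `ℓ ∈ s` with initial amplitudes `X_ℓ ≥ 0`, rates `r_ℓ ≥ 0`, window length `τ ≥ 0`,
tracked evolved amplitudes `0 ≤ T_ℓ ≤ e^{−r_ℓ τ} X_ℓ + ε·min(1, r_ℓ τ)·X_ℓ` (`0 ≤ ε ≤ 1`), and evolved energy `E′ ≤ Σ T_ℓ²`: then
`((1 − e^{−2}) − 3ε) · Σ_ℓ min(1, r_ℓ τ) X_ℓ² ≤ Σ_ℓ X_ℓ² − E′`. -/
theorem floor_of_modal_tracking {ι : Type*} (s : Finset ι) (X r T : ι → ℝ) {τ ε E' : ℝ} (hτ : 0 ≤ τ) (hε : 0 ≤ ε) (hε1 : ε ≤ 1)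
    (hX : ∀ i ∈ s, 0 ≤ X i) (hr : ∀ i ∈ s, 0 ≤ r i) (hT : ∀ i ∈ s, 0 ≤ T i)
    (htrack : ∀ i ∈ s, T i ≤ Real.exp (-(r i * τ)) * X i + ε * min 1 (r i * τ) * X i) (hE : E' ≤ ∑ i ∈ s, T i ^ 2) :
    ((1 - Real.exp (-2)) - 3 * ε) * ∑ i ∈ s, min 1 (r i * τ) * X i ^ 2 ≤ ∑ i ∈ s, X i ^ 2 - E' := by
  -- `dissip_lower_of_tracking` with `lam := e^{−rτ}`, `c := ε·d·X`
  have h := dissip_lower_of_tracking s X T (fun i => Real.exp (-(r i * τ))) (fun i => ε * min 1 (r i * τ) * X i) hT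
    (fun i hi => by simpa using htrack i hi) hE
  -- termwise: `(1 − λ²) X² − (2λ X c + c²) ≥ ((1−e^{−2}) − 3ε) d X²`
  have hterm : ∀ i ∈ s, ((1 - Real.exp (-2)) - 3 * ε) * (min 1 (r i * τ) * X i ^ 2)
      ≤ (1 - Real.exp (-(r i * τ)) ^ 2) * X i ^ 2
        - (2 * Real.exp (-(r i * τ)) * X i * (ε * min 1 (r i * τ) * X i) + (ε * min 1 (r i * τ) * X i) ^ 2) := by
    intro i hi
    set d : ℝ := min 1 (r i * τ) with hd
    have hd0 : 0 ≤ d := le_min zero_le_one (mul_nonneg (hr i hi) hτ)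
    have hd1 : d ≤ 1 := min_le_left _ _
    have hlam0 : 0 < Real.exp (-(r i * τ)) := Real.exp_pos _
    have hlam1 : Real.exp (-(r i * τ)) ≤ 1 := by
      rw [Real.exp_le_one_iff]; exact neg_nonpos.2 (mul_nonneg (hr i hi) hτ)
    -- `1 − λ² ≥ 1 − e^{−2 r τ} ≥ (1 − e^{−2}) d`
    have hdecay : (1 - Real.exp (-2)) * d ≤ 1 - Real.exp (-(r i * τ)) ^ 2 := by
      have h1 := decayWeight_le_one_sub_exp (hr i hi) hτ
      have h2 : Real.exp (-(r i * τ)) ^ 2 = Real.exp (-(2 * (r i * τ))) := by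
        rw [← Real.exp_nat_mul]; congr 1; ring
      rw [hd, h2]; exact h1
    have hX0 := hX i hi
    have hX2 : 0 ≤ X i ^ 2 := sq_nonneg _
    -- error terms: `2λXc + c² ≤ (2ε + ε²) d X² ≤ 3ε d X²`
    have herr : 2 * Real.exp (-(r i * τ)) * X i * (ε * d * X i) + (ε * d * X i) ^ 2 ≤ 3 * ε * (d * X i ^ 2) := by
      have a1 : 2 * Real.exp (-(r i * τ)) * X i * (ε * d * X i) ≤ 2 * (ε * d * X i ^ 2) := by
        have : Real.exp (-(r i * τ)) * (ε * d * X i ^ 2) ≤ 1 * (ε * d * X i ^ 2) :=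
          mul_le_mul_of_nonneg_right hlam1 (by positivity)
        nlinarith
      have a2 : (ε * d * X i) ^ 2 ≤ ε * d * X i ^ 2 := by
        have : ε * d ≤ 1 := by nlinarith
        have h3 : (ε * d) ^ 2 ≤ ε * d := by nlinarith [mul_nonneg hε hd0]
        calc (ε * d * X i) ^ 2 = (ε * d) ^ 2 * X i ^ 2 := by ring
          _ ≤ (ε * d) * X i ^ 2 := mul_le_mul_of_nonneg_right h3 hX2
          _ = ε * d * X i ^ 2 := by ring
      nlinarith
    have hmain : ((1 - Real.exp (-2)) - 3 * ε) * (d * X i ^ 2) ≤ (1 - Real.exp (-(r i * τ)) ^ 2) * X i ^ 2 - 3 * ε * (d * X i ^ 2) := by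
      have := mul_le_mul_of_nonneg_right hdecay hX2
      nlinarith
    linarith [hmain, herr]
  have hsum := Finset.sum_le_sum hterm
  rw [← Finset.mul_sum, Finset.sum_sub_distrib] at hsum
  exact hsum.trans h

end Summit.AnomalousDissipation.AnomalousDissipation.Theorems.SolenoidalFractalHomogenisation.LagrangianStep
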